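import Mathlib
import Summits.BirchSwinnertonDyer.BirchSwinnertonDyer.Theorems.ResidualThetaTransportAtTwoLambdaLowerBoundOExact
import Literature.NumberTheory.EllipticCurves.GreenbergSelmerCofreeReductionPkProofs
import Literature.NumberTheory.EllipticCurves.TateModule
import Literature.NumberTheory.EllipticCurves.ComplexMultiplicationHasCMProofs

/-!
# Sketch (stub-ideation k4 g14, family 3 «assume the opposite») for `stub_cmLambdaLower` = RSL_g (stmt-BirchSwinnertonDyer-22608)
# under crux (R≥)ᵖ `ResidualThetaCountLowerPureAtTwo` (stmt-BirchSwinnertonDyer-26074), route RTT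

Target of this sketch: the critic's decision point **S63 / U52** (STUB-PLAN rev 15–16): before `stub_plusColemanO` (S2) is typed,
decide whether the injectivity of `a ↦ 𝒸 (a • z) : Λ_𝒪 → ℤ₂⟦X⟧ⁿ` follows from `(nz⁺)` ALONE (default) or needs K0b (Kato 12.4).
Family-3 method: assume the opposite of each sub-claim, push the minimal counter-model, and type the lemma it forces.

* §A (opposite O1 «`a ↦ 𝒸(a•z)` has a kernel»): over a commutative DOMAIN, a linear map from a finite torsion-free module into a
  finite module of no larger rank whose cokernel is torsion is injective (rank–nullity, `HasRankNullity` of domains) —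
  `injective_of_finrank_le_of_isTorsion_quotient`, and its free form `injective_of_isTorsion_quotient_pi` (`f ≤ n`);
  the minimal counter-model `(a, b) ↦ a + b : ℤ² → ℤ` shows the rank hypothesis `f ≤ n` cannot be dropped (O1′).
* §B (opposite O2 «`(nz⁺)` holds but the cokernel is not `Λ`-torsion»): impossible — for ANY `R⟦X⟧`-module `M`
  (no finite generation needed), `dim_K (K ⊗_R M) < ∞` forces `M` to be `R⟦X⟧`-torsion (`1, X, …, X^D` acting on `y` are
  `K`-dependent; clear denominators; `IsLocalizedModule.eq_zero_iff`) — `isTorsion_of_finite_baseChange`. So `(nz⁺)` ⇒ the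
  cokernel of `a ↦ 𝒸(a•z)` is torsion, with NO appeal to K0b.
* §C (opposite O3 «`n ≠ f`», U52 (a)): an additive `Θ : A ≃+ (Fin n → B)` with `#A[2] = 2^{2f}`, `#B[2] = 4` forces `n = f` —
  `eq_of_addEquiv_pi_of_natCard_torsionBy` (for `A = Cofree ρ F`, `B = W[2^∞]`: `#A_ρ[2] = #(𝒪/2)² = 2^{2[𝒪:ℤ₂]}`, `#W[2] = 4`).
* §C′ (**U52 (a) in the REGISTERED currency, fully proved — the headline of this sketch**): `n_eq_of_theta S ρ W B Θ : n = f` for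
  `ρ : FramedGaloisRep ℚ (padicCoeffIntegers S) 2`, `B : (Fin f → ℤ_[2]) ≃+ padicCoeffIntegers S` (the supply's basis binder) and ONE
  `Θ : Cofree ρ (padicCoeffField S) ≃+ (Fin n → W.geomPrimaryTorsion 2)` (RSL_g's `Θ v hv` at any `v ∣ 2`), `W` elliptic over a
  `char 0` field: via `natCard_torsionBy_cofree` (`#A_ρ[p^k] = #(𝒪/p^k)^m`, from the tree's `divPowCofreeMkTorsion_surjective` +
  `divPowCofreeMk_eq_iff`), `natCard_quotient_span_natCast_of_addEquiv` (`#(𝒪/q) = #(ℤ_p/q)^f` along an ADDITIVE basis),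
  `natCard_padicInt_quotient_span` (`#(ℤ_p/p) = p`), `natCard_torsionBy_geomPrimaryTorsion` (`#E[p^∞][p] = p²`, from the tree's
  `WeierstrassCurve.natCard_torsionBy_geomPoints`); general rank `m`: `two_mul_eq_mul_of_theta : 2 * n = m * f`.
* §D (opposite O4 «the zeta line meets the `S₀`-block», V2A-PINS §5 (b)): once `φ₁ := a ↦ 𝒸(a•z)` is injective, the COUNT splits —
  `λ((N₁ × N₂)/graph) = λ(N₂) + λ(N₁/range φ₁)` — `finrank_baseChange_prod_quotient_eq` (three-term exactness fed to the tree's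
  `LambdaLowerBoundO.finrank_baseChange_eq_of_exact_three`).
* §E (opposite O5 «a level prime outside `S₀`», re T40): vacuous under RSL_g's binder `hMS` — a prime dividing `2M` is `2` or divides `M`.

CONCURRENCY NOTE. Card k3-g12 (filed 01:46Z, while this seat was typing) proves the algebra of §A/§B/§D independently (its S2a TORS,
S2b INJ, S2d PUSH) and shows that for the registered ADDITIVE `𝒸` U52 (b) needs the two linearity identities LIN-X / LIN-C₀ on `Λ_𝒪·z`;
§A/§B/§D below are kept as an independent confirmation in slightly different generality (torsion for ANY `R⟦X⟧`-module over any domain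
`R`; the rank–nullity form with `finrank M ≤ finrank N` and its necessity O1′) and are NOT this card's claim. This card's claim is §C/§C′
(U52 (a), which k3-g12 assumes as «the index set on both sides») and §E.

Pure algebra plus two counting facts read off the tree (`#E[n] = n²`, `T/p^kT ≅ A[p^k]`); nothing about Selmer groups or
`L`-functions. BSD is NOT proved by any of this; 22608 / 26074 stay OPEN; this file closes nothing and is not a proposal.
-/

set_option autoImplicit false
set_option linter.dupNamespace false

noncomputable section

open scoped TensorProduct

namespace Summit.BirchSwinnertonDyer.BirchSwinnertonDyer.Cruxes.ResidualThetaCountLowerPureAtTwo.SideaK4G14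

universe u v w

/-! ## §A  O1: torsion cokernel + rank count ⇒ injective (rank–nullity over a domain) -/

section RankNullity

variable {R : Type u} [CommRing R] [IsDomain R]
  {M : Type v} {N : Type w} [AddCommGroup M] [Module R M] [AddCommGroup N] [Module R N]

/-- A submodule with torsion quotient has full rank. [folklore] -/
theorem finrank_range_eq_of_isTorsion_quotient [Module.Finite R N] (φ : M →ₗ[R] N)
    (htors : Module.IsTorsion R (N ⧸ LinearMap.range φ)) :
    Module.finrank R (LinearMap.range φ) = Module.finrank R N := by
  have h := Submodule.finrank_quotient_add_finrank (LinearMap.range φ)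
  have h0 : Module.finrank R (N ⧸ LinearMap.range φ) = 0 :=
    Module.finrank_eq_zero_iff_isTorsion.mpr htors
  omega

/-- **U52 (b), abstract form.** Over a commutative domain `R`: a linear map `φ : M → N` of finite modules with `M`
torsion-free, `rank M ≤ rank N` and TORSION cokernel `N ⧸ range φ` is injective (rank–nullity: `rank (ker φ) =
rank M − rank (range φ) = rank M − rank N ≤ 0`, and a rank-zero submodule of a torsion-free module is `0`). [folklore] -/
theorem injective_of_finrank_le_of_isTorsion_quotient [Module.Finite R M] [Module.Finite R N]
    [Module.IsTorsionFree R M] (φ : M →ₗ[R] N) (hle : Module.finrank R M ≤ Module.finrank R N)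
    (htors : Module.IsTorsion R (N ⧸ LinearMap.range φ)) : Function.Injective φ := by
  have hrange := finrank_range_eq_of_isTorsion_quotient φ htors
  have hdisj : Disjoint (⊤ : Submodule R M) (LinearMap.ker φ) := by
    refine Submodule.disjoint_ker_of_finrank_le φ ?_
    rw [finrank_top, Submodule.map_top, hrange]
    exact hle
  rw [← LinearMap.ker_eq_bot]
  exact hdisj.eq_bot_of_ge le_top

/-- **U52 (b), free form** (the shape the LEAD meets after `Λ_𝒪 ≅ Λ^f` by a `ℤ₂`-basis of `𝒪`): a `Λ`-linear
`φ : Λ^f → Λ^n` with `f ≤ n` and torsion cokernel is injective. [folklore] -/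
theorem injective_of_isTorsion_quotient_pi {f n : ℕ} (φ : (Fin f → R) →ₗ[R] (Fin n → R)) (hle : f ≤ n)
    (htors : Module.IsTorsion R ((Fin n → R) ⧸ LinearMap.range φ)) : Function.Injective φ :=
  injective_of_finrank_le_of_isTorsion_quotient φ (by simpa [Module.finrank_pi] using hle) htors

/-- **O1′ — the rank hypothesis is necessary** (minimal counter-model): `(a, b) ↦ a + b : ℤ² → ℤ¹` has torsion (indeed zero)
cokernel but is not injective; so U52 (b) genuinely needs U52 (a) `n = f` (at least `f ≤ n`). [folklore] -/
theorem opposite_rank_hypothesis_needed :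
    ∃ φ : (Fin 2 → ℤ) →ₗ[ℤ] (Fin 1 → ℤ),
      Module.IsTorsion ℤ ((Fin 1 → ℤ) ⧸ LinearMap.range φ) ∧ ¬ Function.Injective φ := by
  let π : Fin 2 → (Fin 2 → ℤ) →ₗ[ℤ] ℤ := LinearMap.proj (R := ℤ) (φ := fun _ : Fin 2 ↦ ℤ)
  let φ : (Fin 2 → ℤ) →ₗ[ℤ] (Fin 1 → ℤ) := LinearMap.pi fun _ : Fin 1 ↦ π 0 + π 1
  have hφ : ∀ a : Fin 2 → ℤ, φ a = fun _ ↦ a 0 + a 1 := fun a ↦ rfl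
  refine ⟨φ, ?_, ?_⟩
  · intro q
    refine ⟨1, ?_⟩
    induction q using Submodule.Quotient.induction_on with
    | H x =>
      rw [one_smul, Submodule.Quotient.mk_eq_zero, LinearMap.mem_range]
      refine ⟨fun i ↦ if i = 0 then x 0 else 0, ?_⟩
      rw [hφ]
      ext i
      have hi : i = 0 := Subsingleton.elim _ _
      subst hi
      simp
  · intro h
    have h01 := @h (fun i ↦ if i = 0 then 1 else 0) (fun i ↦ if i = 0 then 0 else 1) (by rw [hφ, hφ]; ext; simp)
    have := congr_fun h01 0
    simp at this

end RankNullity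

/-! ## §B  O2: `(nz⁺)` (finite-dimensionality after `K ⊗_R ·`) ⇒ `R⟦X⟧`-torsion, for ANY module -/

section Torsion

variable {R : Type u} [CommRing R] [IsDomain R] (K : Type w) [Field K] [Algebra R K] [IsFractionRing R K]
  {M : Type v} [AddCommGroup M] [Module (PowerSeries R) M] [Module R M] [IsScalarTower R (PowerSeries R) M]

open PowerSeries in
/-- **`dim_K (K ⊗_R M) < ∞ ⇒ M` is `R⟦X⟧`-torsion** (`R` a domain with fraction field `K`, `M` any `R⟦X⟧`-module with the
restricted `R`-structure; no finite generation assumed): for `y ∈ M` the `D + 1` vectors `1 ⊗ Xⁱy` (`D = dim`) are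
`K`-dependent; clearing denominators gives `P ∈ R[X] ∖ 0` with `1 ⊗ P·y = 0`, i.e. `s·P·y = 0` for some `s ∈ R ∖ 0`
(`K ⊗_R M` is the localisation of `M` at `R ∖ 0`). This is the `(nz⁺) ⇒ torsion cokernel` step of U52 (b) with NO Kato 12.4.
[folklore] -/
theorem isTorsion_of_finite_baseChange [Module.Finite K (K ⊗[R] M)] : Module.IsTorsion (PowerSeries R) M := by
  classical
  intro y
  set D := Module.finrank K (K ⊗[R] M) with hD
  let v : Fin (D + 1) → K ⊗[R] M := fun i ↦ (1 : K) ⊗ₜ[R] (((X : PowerSeries R) ^ (i : ℕ)) • y)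
  have hv : ¬ LinearIndependent K v := by
    intro h
    have h' := h.fintype_card_le_finrank
    simp only [Fintype.card_fin] at h'
    omega
  obtain ⟨g, hg, i₀, hi₀⟩ := Fintype.not_linearIndependent_iff.mp hv
  obtain ⟨b, hb⟩ := IsLocalization.exist_integer_multiples_of_finite (nonZeroDivisors R) g
  choose c hc using hb
  -- the clearing polynomial, read in `R⟦X⟧`
  set P : PowerSeries R := ∑ i : Fin (D + 1), C (c i) * X ^ (i : ℕ) with hP
  have hcoeff : ∀ i : Fin (D + 1), coeff (i : ℕ) P = c i := by
    intro i
    simp only [hP, map_sum, coeff_C_mul_X_pow, Fin.val_inj, Finset.sum_ite_eq, Finset.mem_univ, if_true]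
  have hb0 : algebraMap R K (b : R) ≠ 0 :=
    IsFractionRing.to_map_ne_zero_of_mem_nonZeroDivisors b.2
  have hP0 : P ≠ 0 := by
    intro h0
    apply hi₀
    have hci : c i₀ = 0 := by rw [← hcoeff i₀, h0, map_zero]
    have : (b : R) • g i₀ = 0 := by rw [← hc i₀, hci, map_zero]
    rw [Algebra.smul_def] at this
    exact (mul_eq_zero.mp this).resolve_left hb0
  -- `1 ⊗ P • y = 0`
  have hterm : ∀ i : Fin (D + 1), (b : R) • (g i • v i) = (1 : K) ⊗ₜ[R] ((C (c i) * X ^ (i : ℕ)) • y) := by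
    intro i
    rw [← smul_assoc, ← hc i, algebraMap_smul, mul_smul, C_eq_algebraMap, algebraMap_smul,
      TensorProduct.tmul_smul]
  have hPy : (1 : K) ⊗ₜ[R] (P • y) = 0 := by
    have h1 : (b : R) • ∑ i, g i • v i = 0 := by rw [hg, smul_zero]
    rw [Finset.smul_sum, Finset.sum_congr rfl fun i _ ↦ hterm i, ← TensorProduct.tmul_sum,
      ← Finset.sum_smul] at h1
    exact h1
  obtain ⟨s, hs⟩ := (IsLocalizedModule.eq_zero_iff (nonZeroDivisors R) (TensorProduct.mk R K M 1)).mp hPy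
  refine ⟨⟨C (s : R) * P, mem_nonZeroDivisors_of_ne_zero (mul_ne_zero ?_ hP0)⟩, ?_⟩
  · exact fun h ↦ nonZeroDivisors.coe_ne_zero s (by simpa using (C_injective (R := R)) (h.trans (map_zero C).symm))
  · change (C (s : R) * P) • y = 0
    rw [mul_smul, C_eq_algebraMap, algebraMap_smul]
    exact hs

/-- **Corollary (the U52 (b) decision, (nz⁺) road): `(nz⁺)` alone makes the cokernel of `a ↦ 𝒸(a•z)` torsion, so §A applies.**
For a `Λ`-linear `φ : Λ^f → Λ^n` (`Λ = R⟦X⟧`), `f ≤ n`, with `dim_K (K ⊗_R (Λ^n ⧸ range φ)) < ∞`: `φ` is injective. [folklore] -/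
theorem injective_of_finite_baseChange_quotient {f n : ℕ}
    (φ : (Fin f → PowerSeries R) →ₗ[PowerSeries R] (Fin n → PowerSeries R)) (hle : f ≤ n)
    [Module.Finite K (K ⊗[R] ((Fin n → PowerSeries R) ⧸ LinearMap.range φ))] : Function.Injective φ :=
  injective_of_isTorsion_quotient_pi φ hle (isTorsion_of_finite_baseChange K)

/-- **Remark (why `(nz⁺)` must be the `Module.Finite` clause, not a bare `finrank` bound):** `Module.finrank` of a module that is
not finite-dimensional is the junk value `0`, so an inequality `… ≤ finrank` alone carries no torsion information. [folklore] -/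
example {V : Type v} [AddCommGroup V] [Module K V] (h : ¬ Module.Finite K V) : Module.finrank K V = 0 :=
  Module.finrank_of_not_finite h

end Torsion

/-! ## §C  O3 / U52 (a): `Θ : A ≃+ (Fin n → B)` with `#A[2] = 2^{2f}`, `#B[2] = 4` forces `n = f` -/

section Count

variable {A : Type u} {B : Type v} [AddCommGroup A] [AddCommGroup B]

/-- Membership in the `n`-torsion subgroup. [folklore] -/
theorem mem_torsionBy_iff' (C : Type w) [AddCommGroup C] (n : ℤ) (x : C) :
    x ∈ AddSubgroup.torsionBy C n ↔ n • x = 0 :=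
  Submodule.mem_torsionBy_iff (R := ℤ) n x

/-- `#(Bⁿ)[m] = (#B[m])ⁿ`. [folklore] -/
theorem natCard_torsionBy_pi (k : ℕ) (m : ℤ) :
    Nat.card (AddSubgroup.torsionBy (Fin k → B) m) = Nat.card (AddSubgroup.torsionBy B m) ^ k := by
  have e : AddSubgroup.torsionBy (Fin k → B) m ≃ (Fin k → AddSubgroup.torsionBy B m) :=
    (Equiv.subtypeEquivRight (p := fun g : Fin k → B ↦ g ∈ AddSubgroup.torsionBy (Fin k → B) m)
        (q := fun g : Fin k → B ↦ ∀ i, g i ∈ AddSubgroup.torsionBy B m) fun g ↦ by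
          simp only [mem_torsionBy_iff', funext_iff, Pi.smul_apply, Pi.zero_apply]).trans
      (Equiv.subtypePiEquivPi (p := fun _ b ↦ b ∈ AddSubgroup.torsionBy B m))
  rw [Nat.card_congr e, Nat.card_pi, Finset.prod_const, Finset.card_univ, Fintype.card_fin]

/-- **U52 (a), abstract form: an additive equivalence `A ≃+ (Fin n → B)` with `#A[2] = 2^{2f}` and `#B[2] = 4` forces `n = f`.**
(For RSL_g: `A = Cofree ρ F` has `#A[2] = #(T_ρ/2T_ρ) = #(𝒪/2)² = 2^{2[𝒪:ℤ₂]}`, `B = W[2^∞]` has `#B[2] = 4`, so the number `n` of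
`Θ`-coordinates IS `[𝒪:ℤ₂]`, the `f` of the supply's basis `B : ℤ₂^f ≃+ 𝒪`.) [folklore] -/
theorem eq_of_addEquiv_pi_of_natCard_torsionBy {n f : ℕ} (e : A ≃+ (Fin n → B))
    (hA : Nat.card (AddSubgroup.torsionBy A 2) = 2 ^ (2 * f))
    (hB : Nat.card (AddSubgroup.torsionBy B 2) = 4) : n = f := by
  have h1 : Nat.card (AddSubgroup.torsionBy A 2) = Nat.card (AddSubgroup.torsionBy (Fin n → B) 2) := by
    refine Nat.card_congr (e.toEquiv.subtypeEquiv fun a ↦ ?_)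
    rw [mem_torsionBy_iff', mem_torsionBy_iff', AddEquiv.toEquiv_eq_coe, AddEquiv.coe_toEquiv, ← map_zsmul,
      e.map_eq_zero_iff]
  rw [h1, natCard_torsionBy_pi, hB, show (4 : ℕ) = 2 ^ 2 by norm_num, ← pow_mul] at hA
  have := Nat.pow_right_injective (le_refl 2) hA
  omega

end Count


/-! ## §C′  U52 (a) in the REGISTERED currency: `#A_ρ[p^k] = #(𝒪/p^k)^m`, `#E[p^∞][p] = p²`, `#(𝒪/q) = #(ℤ_p/q)^f` -/

section RegisteredCount

open Literature.NumberTheory.EllipticCurves Literature.NumberTheory.EllipticCurves.GreenbergSelmer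
  Literature.NumberTheory.GaloisRepresentations

/-- **`#A_ρ[p^k] = #(𝒪/p^k 𝒪)^m`** for `A_ρ = Cofree ρ F = Fⁿ/𝒪ⁿ` (`F = ℚ_p(S)`, `𝒪` its integers, `ρ` framed of rank `m`):
the tree's `divPowCofreeMkTorsion S ρ k : 𝒪^m →+ A_ρ[p^k]` is onto (`divPowCofreeMkTorsion_surjective`) with fibres the cosets of
`p^k 𝒪^m` (`divPowCofreeMk_eq_iff`), so `A_ρ[p^k] ≃ (𝒪/p^k)^m` as sets. [folklore] -/
theorem natCard_torsionBy_cofree {p : ℕ} [Fact p.Prime] (S : Set (PadicAlgCl p)) {m : ℕ}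
    (ρ : FramedGaloisRep ℚ (padicCoeffIntegers S) m) (k : ℕ) :
    Nat.card (AddSubgroup.torsionBy (Cofree ρ (padicCoeffField S)) ((p ^ k : ℕ) : ℤ)) =
      Nat.card (padicCoeffIntegers S ⧸ Ideal.span {((p : padicCoeffIntegers S)) ^ k}) ^ m := by
  classical
  set I : Ideal (padicCoeffIntegers S) := Ideal.span {((p : padicCoeffIntegers S)) ^ k} with hI
  have hsurj := divPowCofreeMkTorsion_surjective S ρ k
  let red : (Fin m → padicCoeffIntegers S) → (Fin m → padicCoeffIntegers S ⧸ I) := fun t i ↦ Ideal.Quotient.mk I (t i)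
  have hred : ∀ t t', red t = red t' ↔ divPowCofreeMk S ρ k t = divPowCofreeMk S ρ k t' := by
    intro t t'
    rw [divPowCofreeMk_eq_iff, funext_iff]
    exact forall_congr' fun i ↦ Ideal.Quotient.eq
  let ψ : AddSubgroup.torsionBy (Cofree ρ (padicCoeffField S)) ((p ^ k : ℕ) : ℤ) → (Fin m → padicCoeffIntegers S ⧸ I) :=
    fun a ↦ red (Function.surjInv hsurj a)
  have hψ : Function.Bijective ψ := by
    constructor
    · intro a a' h
      have h' := (hred _ _).mp h
      rw [← coe_divPowCofreeMkTorsion_apply, ← coe_divPowCofreeMkTorsion_apply, Function.surjInv_eq hsurj,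
        Function.surjInv_eq hsurj] at h'
      exact Subtype.ext h'
    · intro q
      obtain ⟨t, ht⟩ : ∃ t : Fin m → padicCoeffIntegers S, red t = q := by
        choose t ht using fun i ↦ Ideal.Quotient.mk_surjective (q i)
        exact ⟨t, funext ht⟩
      refine ⟨divPowCofreeMkTorsion S ρ k t, ?_⟩
      rw [← ht]
      show red _ = red t
      rw [hred, ← coe_divPowCofreeMkTorsion_apply, ← coe_divPowCofreeMkTorsion_apply, Function.surjInv_eq hsurj]
  rw [Nat.card_congr (Equiv.ofBijective ψ hψ), Nat.card_pi, Finset.prod_const, Finset.card_univ, Fintype.card_fin]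

/-- **`#E[p^∞][p] = p²`** (`char K = 0`): the `p`-torsion of the `p`-primary part `E[p^∞] ⊆ E(K̄)` is `E[p]` (same points), counted
by the tree's `WeierstrassCurve.natCard_torsionBy_geomPoints` (Silverman *AEC* III.6.4 (b)). [folklore] -/
theorem natCard_torsionBy_geomPrimaryTorsion {K : Type u} [Field K] [CharZero K] (W : WeierstrassCurve K) [W.IsElliptic]
    (p : ℕ) (hp : p ≠ 0) :
    Nat.card (AddSubgroup.torsionBy (W.geomPrimaryTorsion p) (p : ℤ)) = p ^ 2 := by
  have key : ∀ P : W.geomPoints, (p : ℤ) • P = 0 → P ∈ W.geomPrimaryTorsion p := fun P hP ↦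
    (AddCommGroup.mem_primaryComponent).mpr ⟨1, by rw [pow_one, ← natCast_zsmul]; exact hP⟩
  have e : AddSubgroup.torsionBy (W.geomPrimaryTorsion p) (p : ℤ) ≃ AddSubgroup.torsionBy W.geomPoints (p : ℤ) :=
    { toFun := fun m ↦ ⟨(m.1 : W.geomPoints), by
        rw [mem_torsionBy_iff', ← AddSubgroupClass.coe_zsmul, (mem_torsionBy_iff' _ _ m.1).mp m.2,
          ZeroMemClass.coe_zero]⟩
      invFun := fun P ↦ ⟨⟨P.1, key P.1 ((mem_torsionBy_iff' _ _ P.1).mp P.2)⟩, by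
        rw [mem_torsionBy_iff', Subtype.ext_iff, AddSubgroupClass.coe_zsmul, ZeroMemClass.coe_zero]
        exact (mem_torsionBy_iff' _ _ P.1).mp P.2⟩
      left_inv := fun m ↦ rfl
      right_inv := fun P ↦ rfl }
  rw [Nat.card_congr e, WeierstrassCurve.natCard_torsionBy_geomPoints (W := W) (by exact_mod_cast hp), Int.natAbs_natCast]

/-- **`#(ℤ_p / p ℤ_p) = p`.** [folklore] -/
theorem natCard_padicInt_quotient_span (p : ℕ) [Fact p.Prime] : Nat.card (ℤ_[p] ⧸ Ideal.span {(p : ℤ_[p])}) = p := by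
  have hker : RingHom.ker (PadicInt.toZMod : ℤ_[p] →+* ZMod p) = Ideal.span {(p : ℤ_[p])} := by
    rw [PadicInt.ker_toZMod, PadicInt.maximalIdeal_eq_span_p]
  have e : ℤ_[p] ⧸ Ideal.span {(p : ℤ_[p])} ≃+* ZMod p :=
    (Ideal.quotEquivOfEq hker.symm).trans (RingHom.quotientKerEquivOfSurjective (ZMod.ringHom_surjective PadicInt.toZMod))
  rw [Nat.card_congr e.toEquiv, Nat.card_zmod]

/-- **`#(𝒪/q𝒪) = #(ℤ_p/q)^f` along an ADDITIVE basis `B : ℤ_p^f ≃+ 𝒪`** (the `f` of the supply's binder): `B` carries `q·ℤ_p^f` onto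
`q𝒪` (additivity alone), the quotient of a product is the product of quotients. [folklore] -/
theorem natCard_quotient_span_natCast_of_addEquiv {p : ℕ} [Fact p.Prime] {𝒪 : Type u} [CommRing 𝒪] {f : ℕ} (q : ℕ)
    (B : (Fin f → ℤ_[p]) ≃+ 𝒪) :
    Nat.card (𝒪 ⧸ Ideal.span {(q : 𝒪)}) = Nat.card (ℤ_[p] ⧸ Ideal.span {(q : ℤ_[p])}) ^ f := by
  classical
  set I : Ideal 𝒪 := Ideal.span {(q : 𝒪)} with hI
  set J : Ideal ℤ_[p] := Ideal.span {(q : ℤ_[p])} with hJ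
  let e₁ : (𝒪 ⧸ I.restrictScalars ℤ) ≃ₗ[ℤ] 𝒪 ⧸ I := Submodule.Quotient.restrictScalarsEquiv ℤ I
  let L : (Fin f → ℤ_[p]) ≃ₗ[ℤ] 𝒪 := B.toIntLinearEquiv
  have hmap : (Submodule.pi Set.univ fun _ : Fin f ↦ J.restrictScalars ℤ).map (L : (Fin f → ℤ_[p]) →ₗ[ℤ] 𝒪) =
      I.restrictScalars ℤ := by
    ext x
    simp only [Submodule.mem_map, Submodule.mem_pi, Set.mem_univ, true_implies, Submodule.restrictScalars_mem, hJ, hI,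
      Ideal.mem_span_singleton']
    constructor
    · rintro ⟨y, hy, rfl⟩
      choose w hw using hy
      refine ⟨B w, ?_⟩
      have hyw : y = q • w := funext fun i ↦ by rw [Pi.smul_apply, nsmul_eq_mul, ← hw i, mul_comm]
      rw [hyw]
      change B w * q = B (q • w)
      rw [map_nsmul, nsmul_eq_mul, mul_comm]
    · rintro ⟨a, rfl⟩
      refine ⟨q • B.symm a, fun i ↦ ⟨B.symm a i, by rw [Pi.smul_apply, nsmul_eq_mul, mul_comm]⟩, ?_⟩
      change B (q • B.symm a) = a * q
      rw [map_nsmul, B.apply_symm_apply, nsmul_eq_mul, mul_comm]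
  let e₂ := Submodule.Quotient.equiv (Submodule.pi Set.univ fun _ : Fin f ↦ J.restrictScalars ℤ) (I.restrictScalars ℤ) L hmap
  let e₃ := Submodule.quotientPi (R := ℤ) (fun _ : Fin f ↦ J.restrictScalars ℤ)
  let e₄ : (ℤ_[p] ⧸ J.restrictScalars ℤ) ≃ₗ[ℤ] ℤ_[p] ⧸ J := Submodule.Quotient.restrictScalarsEquiv ℤ J
  rw [← Nat.card_congr e₁.toEquiv, ← Nat.card_congr e₂.toEquiv, Nat.card_congr e₃.toEquiv, Nat.card_pi,
    Finset.prod_const, Finset.card_univ, Fintype.card_fin, Nat.card_congr e₄.toEquiv]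

/-- **U52 (a) — `n = f` is FORCED by `Θ` (registered currency, no side facts left).** For a framed `ρ : Γ_ℚ → GL_m(𝒪)`,
`𝒪 = 𝒪_{ℚ₂(S)}` with additive basis `B : ℤ₂^f ≃+ 𝒪`, and ONE additive identification `Θ : A_ρ ≃+ (Fin n → E[2^∞])`
(`E/K`, `char K = 0`): `2·n = m·f`; for the curve's `ρ` (`m = 2`): `n = f`. Counting `2`-torsion on both sides:
`#A_ρ[2] = #(𝒪/2)^m = 2^{fm}` (`natCard_torsionBy_cofree`, `natCard_quotient_span_natCast_of_addEquiv`,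
`natCard_padicInt_quotient_span`) and `#E[2^∞][2]ⁿ = 4ⁿ` (`natCard_torsionBy_geomPrimaryTorsion`). [folklore] -/
theorem two_mul_eq_mul_of_theta (S : Set (PadicAlgCl 2)) {m : ℕ} (ρ : FramedGaloisRep ℚ (padicCoeffIntegers S) m)
    {K : Type u} [Field K] [CharZero K] (W : WeierstrassCurve K) [W.IsElliptic] {n f : ℕ}
    (B : (Fin f → ℤ_[2]) ≃+ padicCoeffIntegers S) (Θ : Cofree ρ (padicCoeffField S) ≃+ (Fin n → W.geomPrimaryTorsion 2)) :
    2 * n = m * f := by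
  -- `#A_ρ[2] = 2^{m f}`
  have hA : Nat.card (AddSubgroup.torsionBy (Cofree ρ (padicCoeffField S)) 2) = 2 ^ (m * f) := by
    have h := natCard_torsionBy_cofree S ρ 1
    rw [show (((2 ^ 1 : ℕ) : ℤ)) = 2 by norm_num, pow_one,
      show ((2 : ℕ) : padicCoeffIntegers S) = ((2 : ℕ) : padicCoeffIntegers S) from rfl,
      natCard_quotient_span_natCast_of_addEquiv 2 B, natCard_padicInt_quotient_span, ← pow_mul, mul_comm f m] at h
    exact h
  -- `#(Fin n → E[2^∞])[2] = 4ⁿ`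
  have hB : Nat.card (AddSubgroup.torsionBy (W.geomPrimaryTorsion 2) 2) = 4 := by
    have h := natCard_torsionBy_geomPrimaryTorsion W 2 two_ne_zero
    norm_num at h
    exact h
  have h1 : Nat.card (AddSubgroup.torsionBy (Cofree ρ (padicCoeffField S)) 2) =
      Nat.card (AddSubgroup.torsionBy (Fin n → W.geomPrimaryTorsion 2) 2) := by
    refine Nat.card_congr (Θ.toEquiv.subtypeEquiv fun a ↦ ?_)
    rw [mem_torsionBy_iff', mem_torsionBy_iff', AddEquiv.toEquiv_eq_coe, AddEquiv.coe_toEquiv, ← map_zsmul,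
      Θ.map_eq_zero_iff]
  rw [h1, natCard_torsionBy_pi, hB, show (4 : ℕ) = 2 ^ 2 by norm_num, ← pow_mul] at hA
  have := Nat.pow_right_injective (le_refl 2) hA
  omega

/-- **U52 (a) for the curve's representation (`m = 2`): `n = f`.** [folklore] -/
theorem n_eq_of_theta (S : Set (PadicAlgCl 2)) (ρ : FramedGaloisRep ℚ (padicCoeffIntegers S) 2)
    {K : Type u} [Field K] [CharZero K] (W : WeierstrassCurve K) [W.IsElliptic] {n f : ℕ}
    (B : (Fin f → ℤ_[2]) ≃+ padicCoeffIntegers S) (Θ : Cofree ρ (padicCoeffField S) ≃+ (Fin n → W.geomPrimaryTorsion 2)) :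
    n = f := by
  have := two_mul_eq_mul_of_theta S ρ W B Θ
  omega

end RegisteredCount

/-! ## §D  O4: the zeta line does not meet the `S₀`-block ⇒ the COUNT splits over the place cut -/

section ProductSplit

variable {R : Type u} [CommRing R] (K : Type w) [Field K] [Algebra R K] [IsFractionRing R K]
  {M : Type v} {N₁ N₂ : Type v} [AddCommGroup M] [Module R M] [AddCommGroup N₁] [Module R N₁]
  [AddCommGroup N₂] [Module R N₂]

/-- **The place-cut split of the COUNT (V2A-PINS §5 (b) made a lemma).** For `φ₁ : M → N₁` INJECTIVE and any `φ₂ : M → N₂`,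
the graph quotient `(N₁ × N₂) ⧸ range (φ₁, φ₂)` sits in `0 → N₂ → · → N₁ ⧸ range φ₁ → 0`, hence
`λ((N₁ × N₂)/range(φ₁,φ₂)) = λ(N₂) + λ(N₁/range φ₁)`, `λ = dim_K (K ⊗_R ·)`. (RSL_g: `M = Λ_𝒪·z`, `φ₁ = 𝒸 = col ∘ locd₂`,
`φ₂ = locd_{S₀}`, `N₁ = ℤ₂⟦X⟧ⁿ`, `N₂ = P_{S₀}`; injectivity of `φ₁` = U52 (b) = §A + §B.) [folklore] -/
theorem finrank_baseChange_prod_quotient_eq (φ₁ : M →ₗ[R] N₁) (φ₂ : M →ₗ[R] N₂) (h₁ : Function.Injective φ₁)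
    [FiniteDimensional K (K ⊗[R] ((N₁ × N₂) ⧸ LinearMap.range (φ₁.prod φ₂)))] :
    Module.finrank K (K ⊗[R] ((N₁ × N₂) ⧸ LinearMap.range (φ₁.prod φ₂))) =
      Module.finrank K (K ⊗[R] N₂) + Module.finrank K (K ⊗[R] (N₁ ⧸ LinearMap.range φ₁)) := by
  set L : Submodule R (N₁ × N₂) := LinearMap.range (φ₁.prod φ₂) with hL
  have hle : L ≤ (LinearMap.range φ₁).comap (LinearMap.fst R N₁ N₂) := by
    rintro _ ⟨m, rfl⟩
    exact ⟨m, rfl⟩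
  refine Theorems.LambdaLowerBoundO.finrank_baseChange_eq_of_exact_three K (L.mkQ ∘ₗ LinearMap.inr R N₁ N₂)
    (L.mapQ (LinearMap.range φ₁) (LinearMap.fst R N₁ N₂) hle) ?_ ?_ ?_
  · -- injective: `(0, y) ∈ L ⇒ y = 0`
    rw [injective_iff_map_eq_zero]
    intro y hy
    rw [LinearMap.comp_apply, Submodule.mkQ_apply, Submodule.Quotient.mk_eq_zero, hL, LinearMap.mem_range] at hy
    obtain ⟨m, hm⟩ := hy
    have hm1 : φ₁ m = 0 := congrArg Prod.fst hm
    have hm2 : φ₂ m = y := congrArg Prod.snd hm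
    have hm0 : m = 0 := h₁ (by rw [hm1, map_zero])
    rw [← hm2, hm0, map_zero]
  · -- exact in the middle
    intro q
    induction q using Submodule.Quotient.induction_on with
    | H xy =>
      constructor
      · intro hq
        rw [Submodule.mapQ_apply, Submodule.Quotient.mk_eq_zero, LinearMap.mem_range] at hq
        obtain ⟨m, hm⟩ := hq
        rw [LinearMap.fst_apply] at hm
        refine ⟨xy.2 - φ₂ m, ?_⟩
        rw [LinearMap.comp_apply, Submodule.mkQ_apply, LinearMap.inr_apply, ← sub_eq_zero, ← Submodule.Quotient.mk_sub,
          Submodule.Quotient.mk_eq_zero, hL, LinearMap.mem_range]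
        refine ⟨-m, Prod.ext ?_ ?_⟩
        · change φ₁ (-m) = 0 - xy.1
          rw [map_neg, hm, zero_sub]
        · change φ₂ (-m) = (xy.2 - φ₂ m) - xy.2
          rw [map_neg]
          abel
      · rintro ⟨y, hy⟩
        rw [← hy, LinearMap.comp_apply, Submodule.mkQ_apply, Submodule.mapQ_apply, LinearMap.inr_apply, LinearMap.fst_apply,
          Submodule.Quotient.mk_zero]
  · -- surjective
    intro q
    induction q using Submodule.Quotient.induction_on with
    | H x => exact ⟨Submodule.Quotient.mk (x, 0), by rw [Submodule.mapQ_apply, LinearMap.fst_apply]⟩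

end ProductSplit

/-! ## §E  O5 (re T40): under `hMS` there is no level prime outside `S₀` -/

/-- A prime dividing `2M` is `2` or divides `M`; with RSL_g's binder `hMS : natGenerator v ∣ M → v ∈ S₀` the place set
`{∞} ∪ {v : natGenerator v ∣ 2M} ∪ S₀` of T40 is `{∞, 2} ∪ S₀`. [folklore] -/
theorem eq_two_or_dvd_of_prime_dvd_two_mul {p M : ℕ} (hp : p.Prime) (h : p ∣ 2 * M) : p = 2 ∨ p ∣ M := by
  rcases (Nat.Prime.dvd_mul hp).mp h with h2 | hM
  · exact Or.inl ((Nat.prime_dvd_prime_iff_eq hp Nat.prime_two).mp h2)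
  · exact Or.inr hM

/-- The place-set form: if every `v` with `natGenerator v ∣ M` lies in `S₀`, then every `v` with prime `natGenerator v ∣ 2M` is the
place of `2` or lies in `S₀` (stated over an abstract «generator» function to stay import-free). [folklore] -/
theorem level_places_subset {V : Type u} (gen : V → ℕ) (hgen : ∀ v, (gen v).Prime) (S₀ : Finset V) {M : ℕ}
    (hMS : ∀ v, gen v ∣ M → v ∈ S₀) (v : V) (hv : gen v ∣ 2 * M) : gen v = 2 ∨ v ∈ S₀ :=
  (eq_two_or_dvd_of_prime_dvd_two_mul (hgen v) hv).imp_right (hMS v)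

end Summit.BirchSwinnertonDyer.BirchSwinnertonDyer.Cruxes.ResidualThetaCountLowerPureAtTwo.SideaK4G14

end
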